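import Literature.AlgebraicGeometry.HodgeTheory.SupportedHodgeClassDescent
import Literature.AlgebraicGeometry.HodgeTheory.SupportedHodgeClassesAlgebraic
import Literature.AlgebraicGeometry.HodgeTheory.GysinKernelProofs
import Literature.AlgebraicGeometry.HodgeTheory.SaitoGrFDeRhamCurveNetHolds
import Literature.AlgebraicGeometry.Resolution.ProjectiveResolutionProofs
import Literature.AlgebraicTopology.SingularHomology.GysinMapSupportProofs
import HarnessLib

/-!
# Grothendieck's coniveau filtration is spanned by Gysin images — unconditionally

Family `hodge`, layer `Literature/AlgebraicGeometry/HodgeTheory`. Grothendieck (Topology 8 (1969),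
§1 and p. 300) describes the classes of coniveau `≥ r` on a smooth projective `X` in two ways: the
span `Nʳ Hᵏ(X(ℂ); ℂ) = supportedClasses X k r` of the kernels of the restrictions
`Hᵏ(X(ℂ)) → Hᵏ((X ∖ Z)(ℂ))`, `Z` Zariski-closed of codimension `≥ r`, and the span of the Gysin
images `g_* Hᵃ(Y(ℂ))`, `g : Y ⟶ X` from smooth projective `Y` of dimension `m ≤ n − r`
(`a + 2n = k + 2m`). They agree: "`⊇`" because a Gysin image dies off the (closed, codimension
`≥ n − m ≥ r`) image `g(Y)` (support property of Gysin morphisms, the tree's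
`gysinMap_restrictCompl_eq_zero_of_field`); "`⊆`" by Deligne, Hodge III, Cor. 8.2.8 (the kernel of
the restriction off `Z = ⋃ⱼ gⱼ(Yⱼ)` is the sum of the Gysin images of desingularisations `gⱼ` of the
components of `Z`) and Hironaka (projective resolutions exist). Both inputs are THEOREMS of the tree
(`Deligne1974_ker_restrictCompl_eq_iSup_range_complexGysin_holds`,
`Resolution.Hironaka1964_projective_holds`), so the equality below is unconditional; it was
previously available only granted Cor. 8.2.8 (crux sketch
`Cruxes/TranscendentalOrSupported/Lines/Sketch_gysin.lean`, `r = 1`).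

* `iSup_range_complexGysin_le_supportedClasses` — `Gʳ ≤ Nʳ` (every orientation family);
* `supportedClasses_le_iSup_range_complexGysin` — `Nʳ ≤ Gʳ`;
* `supportedClasses_eq_iSup_range_complexGysin` — `Nʳ = Gʳ`;
* `exists_finite_family_of_le_supportedClasses` — a finite-dimensional `W ≤ Nʳ Hᵏ` lies in the
  sum of the Gysin images of ONE finite family `gⱼ : Yⱼ ⟶ X`, `dim Yⱼ + r ≤ n`.

## References

* [GrothendieckTopology1969] A. Grothendieck, Hodge's general conjecture is false for trivial
  reasons, Topology 8 (1969), §1 and p. 300.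
* [DeligneHodgeIII1974] P. Deligne, Théorie de Hodge III, Cor. 8.2.8 and Prop. 8.2.7.
* [Kollar2007] J. Kollár, Lectures on Resolution of Singularities, Thm. 3.27.
* [VoisinChowRings2014] C. Voisin, Chow Rings, Decomposition of the Diagonal, and the Topology of
  Families, Thm. 2.39 (proof).
-/

noncomputable section

open CategoryTheory AlgebraicGeometry
open Literature.AlgebraicTopology.SingularHomology

namespace Literature.AlgebraicGeometry.HodgeTheory

section HodgeTheory

variable {n : ℕ} {X : Motives.SchemeOver ℂ}

/-- **`Gʳ ≤ Nʳ`**: the Gysin image of `g : Y ⟶ X`, `Y` smooth projective of dimension `m` with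
`m + r ≤ n`, lies in the classes supported in codimension `≥ r` (it dies off the closed image
`g(Y)`, whose points have codimension `≥ n − m ≥ r`: `complexGysin_mem_supportedClasses` with the
support property `gysinMap_restrictCompl_eq_zero_of_field ℂ` and `N⁰ = ⊤` on `Y`).
[cite: GrothendieckTopology1969, §1 and p. 300] -/
theorem iSup_range_complexGysin_le_supportedClasses (μ : OrientationFamily)
    (hX : Motives.IsSmoothProjective n X) (k r : ℕ) :
    (⨆ (m : ℕ) (_ : m + r ≤ n) (Y : Motives.SchemeOver ℂ) (hY : Motives.IsSmoothProjective m Y)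
        (g : Y ⟶ X) (a : ℕ) (hab : a + 2 * n = k + 2 * m),
        LinearMap.range (complexGysin μ hY hX g hab)) ≤ supportedClasses X k r := by
  refine iSup_le fun m ↦ iSup_le fun hm ↦ iSup_le fun Y ↦ iSup_le fun hY ↦
    iSup_le fun g ↦ iSup_le fun a ↦ iSup_le fun hab ↦ ?_
  rintro _ ⟨y, rfl⟩
  exact complexGysin_mem_supportedClasses (gysinMap_restrictCompl_eq_zero_of_field ℂ) μ
    μ.hasPoincareDuality hY hX g hab (r := 0) (s := r) (by omega)
    (by rw [supportedClasses_zero]; exact Submodule.mem_top)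

/-- **`Nʳ ≤ Gʳ`, unconditionally** (Deligne, Hodge III, Cor. 8.2.8, and Hironaka — both theorems
of the tree): a class `x ∈ Nʳ Hᵏ` dies off ONE closed `Z` of codimension `≥ r`
(`exists_isClosed_of_mem_supportedClasses`); `Z = ⋃ⱼ gⱼ(Yⱼ)` for finitely many `gⱼ : Yⱼ ⟶ X`
from smooth projective `Yⱼ` of dimensions `mⱼ + r ≤ n`
(`exists_family_iUnion_range_eq_of_isClosed`, fed with `Hironaka1964_projective_holds`); so
`x ∈ Σⱼ im (gⱼ)_*` (`Deligne1974_ker_restrictCompl_eq_iSup_range_complexGysin_holds`).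
[cite: DeligneHodgeIII1974, Cor. 8.2.8] [cite: GrothendieckTopology1969, p. 300]
[cite: Kollar2007, Thm. 3.27] -/
theorem supportedClasses_le_iSup_range_complexGysin (μ : OrientationFamily)
    (hX : Motives.IsSmoothProjective n X) (k r : ℕ) :
    supportedClasses X k r ≤
      ⨆ (m : ℕ) (_ : m + r ≤ n) (Y : Motives.SchemeOver ℂ) (hY : Motives.IsSmoothProjective m Y)
        (g : Y ⟶ X) (a : ℕ) (hab : a + 2 * n = k + 2 * m),
        LinearMap.range (complexGysin μ hY hX g hab) := by
  intro x hx
  obtain ⟨Z, hZ, hZr, hxZ⟩ := exists_isClosed_of_mem_supportedClasses hx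
  obtain ⟨ι, _, m, Y, hY, g, hZeq, hm⟩ :=
    exists_family_iUnion_range_eq_of_isClosed Resolution.Hironaka1964_projective_holds hX hZ hZr
  have hx' : complexBetti.restrictCompl X (⋃ j, Set.range (g j).left.base) k x = 0 := by
    rw [hZeq]; exact hxZ
  have hmem := Deligne1974_ker_restrictCompl_eq_iSup_range_complexGysin_holds.mem_iSup_range μ
    μ.hasPoincareDuality hX hY g hx'
  revert hmem
  refine fun hmem ↦ (iSup_le fun j ↦ iSup_le fun a ↦ iSup_le fun hab ↦ ?_ :
    (⨆ (j : ι) (a : ℕ) (hab : a + 2 * n = k + 2 * m j),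
      LinearMap.range (complexGysin μ (hY j) hX (g j) hab)) ≤ _) hmem
  exact le_iSup_of_le (m j) (le_iSup_of_le (hm j) (le_iSup_of_le (Y j)
    (le_iSup_of_le (hY j) (le_iSup_of_le (g j) (le_iSup_of_le a (le_iSup_of_le hab le_rfl))))))

/-- **Grothendieck's two descriptions of coniveau `≥ r` agree: `Nʳ Hᵏ(X(ℂ); ℂ)` is the span of the
Gysin images `g_* Hᵃ(Y(ℂ); ℂ)` over the morphisms `g : Y ⟶ X` from smooth projective `Y` with
`dim Y + r ≤ dim X`** — for every orientation family, unconditionally.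
[cite: GrothendieckTopology1969, §1 and p. 300] [cite: DeligneHodgeIII1974, Cor. 8.2.8] -/
theorem supportedClasses_eq_iSup_range_complexGysin (μ : OrientationFamily)
    (hX : Motives.IsSmoothProjective n X) (k r : ℕ) :
    supportedClasses X k r =
      ⨆ (m : ℕ) (_ : m + r ≤ n) (Y : Motives.SchemeOver ℂ) (hY : Motives.IsSmoothProjective m Y)
        (g : Y ⟶ X) (a : ℕ) (hab : a + 2 * n = k + 2 * m),
        LinearMap.range (complexGysin μ hY hX g hab) :=
  le_antisymm (supportedClasses_le_iSup_range_complexGysin μ hX k r)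
    (iSup_range_complexGysin_le_supportedClasses μ hX k r)

/-- **One finite family for a finite-dimensional space of supported classes.** If `W ≤ Nʳ Hᵏ` is
spanned by a finite set, then there is ONE finite family of morphisms `gⱼ : Yⱼ ⟶ X` from smooth
projective `Yⱼ` of dimensions `mⱼ + r ≤ n` with `W ≤ Σⱼ Σₐ im (gⱼ)_*` (each generator dies off a
closed `Zᵢ` of codimension `≥ r`; resolve the components of the finitely many `Zᵢ` at once by
indexing over the pairs). [cite: DeligneHodgeIII1974, Cor. 8.2.8] [cite: GrothendieckTopology1969, p. 300] -/
theorem exists_finite_family_of_span_le_supportedClasses (μ : OrientationFamily)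
    (hX : Motives.IsSmoothProjective n X) {k r : ℕ} (s : Finset (complexBetti X k))
    (hs : ∀ x ∈ s, x ∈ supportedClasses X k r) :
    ∃ (ι : Type) (_ : Finite ι) (m : ι → ℕ) (Y : ι → Motives.SchemeOver ℂ)
      (hY : ∀ j, Motives.IsSmoothProjective (m j) (Y j)) (g : ∀ j, Y j ⟶ X),
      (∀ j, m j + r ≤ n) ∧
      Submodule.span ℂ (↑s : Set (complexBetti X k)) ≤
        ⨆ (j : ι) (a : ℕ) (hab : a + 2 * n = k + 2 * m j),
          LinearMap.range (complexGysin μ (hY j) hX (g j) hab) := by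
  classical
  -- one closed set and one resolved family per generator
  have key : ∀ x : s, ∃ (ι : Type) (_ : Finite ι) (m : ι → ℕ) (Y : ι → Motives.SchemeOver ℂ)
      (hY : ∀ j, Motives.IsSmoothProjective (m j) (Y j)) (g : ∀ j, Y j ⟶ X),
      (∀ j, m j + r ≤ n) ∧
      (x : complexBetti X k) ∈ ⨆ (j : ι) (a : ℕ) (hab : a + 2 * n = k + 2 * m j),
        LinearMap.range (complexGysin μ (hY j) hX (g j) hab) := by
    rintro ⟨x, hxs⟩
    obtain ⟨Z, hZ, hZr, hxZ⟩ := exists_isClosed_of_mem_supportedClasses (hs x hxs)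
    obtain ⟨ι, hι, m, Y, hY, g, hZeq, hm⟩ :=
      exists_family_iUnion_range_eq_of_isClosed Resolution.Hironaka1964_projective_holds hX hZ hZr
    have hx' : complexBetti.restrictCompl X (⋃ j, Set.range (g j).left.base) k x = 0 := by
      rw [hZeq]; exact hxZ
    exact ⟨ι, hι, m, Y, hY, g, hm,
      Deligne1974_ker_restrictCompl_eq_iSup_range_complexGysin_holds.mem_iSup_range μ
        μ.hasPoincareDuality hX hY g hx'⟩
  choose ι hι m Y hY g hm hmem using key
  refine ⟨Σ x : s, ι x, inferInstance, fun p ↦ m p.1 p.2, fun p ↦ Y p.1 p.2, fun p ↦ hY p.1 p.2,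
    fun p ↦ g p.1 p.2, fun p ↦ hm p.1 p.2, ?_⟩
  refine Submodule.span_le.2 fun x hxs ↦ ?_
  have h := hmem ⟨x, hxs⟩
  refine (?_ : (⨆ (j : ι ⟨x, hxs⟩) (a : ℕ) (hab : a + 2 * n = k + 2 * m ⟨x, hxs⟩ j),
      LinearMap.range (complexGysin μ (hY ⟨x, hxs⟩ j) hX (g ⟨x, hxs⟩ j) hab)) ≤ _) h
  refine iSup_le fun j ↦ iSup_le fun a ↦ iSup_le fun hab ↦ ?_
  exact le_iSup_of_le (⟨⟨x, hxs⟩, j⟩ : Σ x : s, ι x) (le_iSup_of_le a (le_iSup_of_le hab le_rfl))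

end HodgeTheory

end Literature.AlgebraicGeometry.HodgeTheory

end
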